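import Literature.AlgebraicGeometry.DuqueFrancoVillaflor2025.ArtinianGorensteinIdeal
import Mathlib.LinearAlgebra.Dual.Lemmas
import Mathlib.RingTheory.Ideal.Quotient.Operations
import HarnessLib

/-!
# The Macaulay dual generator of a connected sum of graded Artinian Gorenstein algebras
# (Iarrobino–McDaniel–Seceleanu 2022, Theorem 1 = Theorem 4.6, with Lemmas 2.1, 2.6–2.7, 3.5, 3.7–3.9)

Topic `Literature/RingTheory/GradedAlgebra`.

A. Iarrobino, C. McDaniel, A. Seceleanu, *Connected sums of graded Artinian Gorenstein algebras and
Lefschetz properties*, J. Pure Appl. Algebra 226 (2022) 106787 = arXiv:1904.06297 [IarrobinoMcDanielSeceleanu2022]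
(text read: arXiv v3, §§2.1, 3.1–3.2, 4.1; theorem / lemma numbers below are those of the arXiv text, which are
the numbers used by the citing records; Theorem 4.6 is "Theorem 1" of the Introduction). Setting of the paper (§2.1, §3.2): `(A, ∫_A)`, `(B, ∫_B)`, `(T, ∫_T)`
oriented graded Artinian Gorenstein (AG) algebras over an ARBITRARY field, of socle degrees `d, d, k`, with
surjections `π_A : A → T`, `π_B : B → T`; THOM CLASS `τ_A ∈ A_{d−k}`: "**Lemma 2.1.** There exists a unique
homogeneous element `τ = τ_π ∈ A_{d−k}` such that `∫_A τ·a = ∫_T π(a)`, `a ∈ A`."; "**Lemma 2.6.** The map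
`π : A → T` is surjective if and only if [the Gysin map] `T(k−d) → A` is injective."; "**Lemma 2.7.** Assume that
`π` is surjective. Then the Gysin map coincides with the multiplication map `×τ : T(k−d) → A`"; FIBRE PRODUCT
"**Definition 3.1.** `A ×_T B = {(a,b) ∈ A ⊕ B | π_A(a) = π_B(b)}`", "**Lemma 3.5.** `H(A ×_T B, t) =
H(A,t) + H(B,t) − H(T,t)`"; CONNECTED SUM "**Definition 3.6.** … the quotient ring of the fibered product
`A ×_T B` by the principal ideal generated by the pair of Thom classes `(τ_A, τ_B)`" (assuming
`π_A(τ_A) = π_B(τ_B)`), "**Lemma 3.7.** There is a short exact sequence of graded vector spaces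
`0 → T(k−d) → A ×_T B → A #_T B → 0`", "**Lemma 3.8.** … the connected sum `A #_T B` is a (not necessarily
standard) graded Artinian Gorenstein algebra", "**Lemma 3.9.** `H(A #_T B, t) = H(A,t) + H(B,t) − (1 + t^{d−k}) H(T,t)`.
Equivalently … `H(A #_T B) = H(A) + H(B) − H(T) − H(T)[d−k]`"; and the first main theorem, in MACAULAY DUALITY
form (`Q = K[x_1..x_n]`, `R` its dual; `Ann F ⊂ Q` the annihilator of a form `F ∈ R_d`):

**Theorem 4.6 (= Theorem 1, verbatim).** "Let `F, G ∈ R_d` be two linearly independent homogeneous forms of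
degree `d`, and suppose that there exists `τ ∈ Q_{d−k}` (for some `k < d`) satisfying (a) `τ∘F = τ∘G ≠ 0`, and
(b) `Ann(τ∘F = τ∘G) = Ann(F) + Ann(G)`. Define the oriented AG algebras `A = Q/Ann(F)`, `B = Q/Ann(G)`,
`T = Q/Ann(τ∘F = τ∘G)`, and let `π_A : A → T` and `π_B : B → T` be the natural projection maps. Then the Thom
classes of `π_A` and `π_B` are given by `τ_A = τ + Ann(F)` and `τ_B = τ + Ann(G)`, and we have algebra
isomorphisms `A ×_T B ≅ Q/(Ann(F) ∩ Ann(G))`, `A #_T B ≅ Q/Ann(F − G)`. And, conversely, every connected sum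
`A #_T B` of graded AG algebras of the same socle degree over a graded AG algebra `T` arises in this way."
Printed proof of `A #_T B ≅ Q/Ann(F−G)` (p. 11): the Mayer–Vietoris sequence
`0 → Q/(I₁∩I₂) → Q/I₁ ⊕ Q/I₂ → Q/(I₁+I₂) → 0` (Remark 3.10), the multiplication sequence
`0 → Q/(I:τ)(k−d) →·τ Q/I → Q/(I+(τ)) → 0` with `I = Ann(F,G)`, `(I : τ) = Ann(τ∘F) ∩ Ann(τ∘G)` "by condition
(a)", Lemma 3.7 (so `A #_T B ≅ Q/(Ann(F,G) + (τ))`), and finally "`Ann(F,G) + (τ) = Ann(F − G)`. But since `A #_T B`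
is Gorenstein, Lemma 4.4 implies that there are constants `a, b ∈ K` for which `Ann(F,G) + (τ) = Ann(aF − bG)`. On
the other hand, since `τ ∈ Ann(aF − bG)`, condition (a) guarantees that `a = b = 1`".

## Dictionary (the tree's Macaulay-duality vocabulary, file `Kloosterman2025/ArtinianGorensteinOfFunctional.lean`)

A form `F ∈ R_d` of the dual ring is the same as a `K`-linear functional `ℓ : S → K` on `S = Q = K[x_σ]`
CONCENTRATED IN DEGREE `d` (`ℓ(p) = ℓ(p_d)`); `Ann(F)` is the tree's `annIdeal ℓ = {g | ℓ(g h) = 0 ∀ h}`; the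
contraction `τ∘F ∈ R_k` is the functional `ℓ_τ := ℓ(· τ) = ℓ ∘ₗ mulRight τ` (concentrated in degree `k = d − e`
for a form `τ` of degree `e`, tree `comp_mulRight_homogeneousComponent`), and `Ann(τ∘F) = (Ann F : τ)` is the
tree's `annIdeal_comp_mulRight`. The orientation of `A = S/annIdeal ℓ` is `ℓ` itself, and the Thom class condition
`∫_A τ·a = ∫_T π_A(a)` of Lemma 2.1 reads `ℓ(τ a) = φ(a)` where `φ` orients `T`. Hilbert functions are written,
as everywhere in the tree, on the graded pieces `idealDegree I a = I ∩ S_a`: `H(S/I)(a) = dim S_a − dim I_a`.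

## What this file proves (theorems only: 0 definitions, 0 named facts, 0 sorry; `K` any field)

* §1 (Definition 3.1 / Remark 3.10 Mayer–Vietoris / Lemma 3.5): for ANY two ideals `I₁, I₂` of a commutative
  ring, `Q → Q/I₁ × Q/I₂` has kernel `I₁ ∩ I₂` and image the fibre product over `Q/(I₁+I₂)`
  (`ker_quotient_prod`, `exists_lift_iff_quotient_sup_eq`); Lemma 3.5 for `I_j = annIdeal ℓ_j`
  (`hilbert_inf_add_hilbert_sup_annIdeal`, the tree's lattice identity).
* §2 (Lemma 2.1 / Definition 2.2 / Lemmas 2.6–2.7, in dual-generator form = Remark 4.3 (b)): for `ℓ`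
  concentrated in degree `t` and `φ` concentrated in degree `k ≤ t` with `annIdeal ℓ ≤ annIdeal φ` (i.e.
  `T = S/annIdeal φ` is a quotient of `A = S/annIdeal ℓ`), there is a form `τ` of degree `t − k` with `ℓ(· τ) = φ`
  (`exists_thomClass`), unique modulo `annIdeal ℓ` (`thomClass_sub_mem_annIdeal`); the Gysin map is
  multiplication by `τ` and is injective: `y τ ∈ annIdeal ℓ ↔ y ∈ annIdeal φ` (`mul_thomClass_mem_annIdeal_iff`).
* §3 (Theorem 4.6, forward direction, and Lemmas 3.7–3.9): for `ℓ₁, ℓ₂` concentrated in degree `t`, a form `τ` of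
  degree `e` with (a) `ℓ₁(· τ) = ℓ₂(· τ)` `=: φ` and (b) `annIdeal φ ≤ annIdeal ℓ₁ + annIdeal ℓ₂` (the printed
  (b) is the equality; `≥` is automatic, `annIdeal_comp_mulRight_eq_sup`):
  **`annIdeal (ℓ₁ − ℓ₂) = (annIdeal ℓ₁ ⊓ annIdeal ℓ₂) + (τ)`** (`annIdeal_sub_eq_inf_sup_span`) — i.e.
  `A #_T B = Q/(Ann(F,G) + (τ)) = Q/Ann(F − G)`; the Gysin injectivity `y τ ∈ Ann(F,G) ↔ y ∈ Ann(τ∘F)` of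
  Lemma 3.7 (`mul_mem_inf_annIdeal_iff`, from (a) alone); **Lemma 3.9** degree by degree
  (`hilbert_connectedSum_add`: `H(A#_TB)(a+e) + H(T)(a+e) + H(T)(a) = H(A)(a+e) + H(B)(a+e)`, and
  `hilbert_connectedSum_add_of_lt` in degrees `a < e`), its dimension core
  `dim (Ann(F−G))_{a+e} + dim (Ann(τ∘F))_a = dim (Ann(F,G))_{a+e} + dim S_a`
  (`finrank_idealDegree_annIdeal_sub_add`); WITHOUT (b) the corresponding inequality
  (`hilbert_annIdeal_sub_add_le`: `(Ann(F,G)) + (τ) ⊆ Ann(F − G)` always); **Lemma 3.8** in the tree's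
  predicate (`isArtinianGorenstein_annIdeal_sub`: `S/annIdeal(ℓ₁ − ℓ₂)` is Artinian Gorenstein of socle degree
  `t` as soon as `ℓ₁ ≠ ℓ₂`); and the RANK form used for catalecticant / period matrices
  (`finrank_range_gradedMulForm_sub`: the rank of `(g,h) ↦ (ℓ₁−ℓ₂)(gh)` on `S_a × S_b`, `a + b = t`, is
  `H(A#_TB)(a)`).
* §4 two Thom lifts (the hypothesis `π_A(τ_A) = π_B(τ_B)` of Definition 3.6 made concrete, and the sentence
  "there is a `τ ∈ Q_{d−k}` such that `(τ_A, τ_B) = τ + Ann(F,G)`" of the proof of Theorem 4.6): forms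
  `τ₁, τ₂` of degree `e` with `ℓ₁(· τ₁) = ℓ₂(· τ₂)` and `τ₁ − τ₂ ∈ annIdeal ℓ₁ + annIdeal ℓ₂` glue to one `τ`
  (`exists_thomClass_glue`), so the `τ`-free conclusions (Lemma 3.9, the rank form) hold in that setting
  (`hilbert_connectedSum_add'`, `finrank_range_gradedMulForm_sub'`).

Proof route. The paper proves `Ann(F,G) + (τ) = Ann(F − G)` through Lemma 3.8 (socle computation) and Lemma 4.4;
this file takes the shorter road available in the dual-generator setting (the one deviation from the printed
proof): if `f ∈ S_i` kills `ℓ₁ − ℓ₂`, the functional `w ↦ ℓ₁(f w) = ℓ₂(f w)` on `S_{t−i}` vanishes on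
`(Ann ℓ₁ + Ann ℓ₂)_{t−i} = (Ann φ)_{t−i}`, hence — by the perfect pairing of `T = S/Ann φ` (tree
`ker_gradedMulForm_flip` + Mathlib `mem_span_of_iInf_ker_le_ker`) — equals `φ(g ·) = ℓ_j(g τ ·)` for a form `g`
of degree `i − e`, and then `f − g τ ∈ Ann ℓ₁ ∩ Ann ℓ₂` by the perfect pairings of `A` and `B`. Lemma 3.8 then
comes for free (`annIdeal` of a non-zero functional, tree `isArtinianGorenstein_annIdeal`), and Lemma 3.9 from the
tree's `(I + (τ))_{a+e} = I_{a+e} + τ S_a` with `I_{a+e} ∩ τ S_a = τ (Ann φ)_a` (Lemma 3.7).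
Hypotheses NOT needed for the forward direction and therefore dropped: "`≠ 0`" in (a), `k < d`, and the linear
independence of `F, G` (used only for `ℓ₁ ≠ ℓ₂` in Lemma 3.8).

NOT formalised: the converse direction of Theorem 4.6 and the abstract (categorical) fibre product / connected
sum of §3 beyond their concrete models `Q/(I₁ ∩ I₂)`, `Q/Ann(F − G)`; §§4.2–6 (Lefschetz properties).

Use (Hodge-locus census, cell pub-hlocus, ENGINE B record THEOREM CS): with `ℓ_j` the socle functionals of the
Artinian Gorenstein ideals of two linear subspaces `P₁, P₂ ⊂ X` and `T` the Jacobian-type algebra of `P₁ ∩ P₂`,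
`finrank_range_gradedMulForm_sub'` is the exact rank of the period matrix of the special pencil member.
HONEST FRAMING (cell pub-hlocus): certified instances and evidence bearing on the general Hodge conjecture; no claim.
-/

noncomputable section

open MvPolynomial Module Literature.RingTheory.MvPolynomial Literature.AlgebraicGeometry.Kloosterman2025
  Literature.AlgebraicGeometry.DuqueFrancoVillaflor2025

attribute [local instance] MvPolynomial.gradedAlgebra

namespace Literature.RingTheory.GradedAlgebra

universe u v

/-! ## §1. The fibre product `Q/(I₁ ∩ I₂) = Q/I₁ ×_{Q/(I₁+I₂)} Q/I₂` (Definition 3.1, Remark 3.10, Lemma 3.5) -/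

section FibreProduct

variable {R : Type u} [CommRing R]

/-- Exactness on the left of the Mayer–Vietoris sequence `0 → Q/(I₁∩I₂) → Q/I₁ ⊕ Q/I₂ → Q/(I₁+I₂) → 0`:
the kernel of `Q → Q/I₁ × Q/I₂` is `I₁ ∩ I₂`, so `Q/(I₁ ∩ I₂)` embeds in `Q/I₁ × Q/I₂`.
[cite: IarrobinoMcDanielSeceleanu2022, Remark 3.10] -/
theorem ker_quotient_prod (I₁ I₂ : Ideal R) :
    RingHom.ker ((Ideal.Quotient.mk I₁).prod (Ideal.Quotient.mk I₂)) = I₁ ⊓ I₂ := by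
  ext q
  simp [RingHom.mem_ker, Prod.ext_iff, Ideal.Quotient.eq_zero_iff_mem]

/-- Exactness in the middle and on the right of the Mayer–Vietoris sequence, i.e. **the image of
`Q → Q/I₁ × Q/I₂` is the fibre product `Q/I₁ ×_{Q/(I₁+I₂)} Q/I₂ = {(a,b) | π₁(a) = π₂(b)}`** of Definition 3.1:
a pair of classes `(ā, b̄)` has a common representative iff `a` and `b` agree in `Q/(I₁ + I₂)`.
[cite: IarrobinoMcDanielSeceleanu2022, Definition 3.1, Remark 3.10] -/
theorem exists_lift_iff_quotient_sup_eq (I₁ I₂ : Ideal R) (a b : R) :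
    (∃ q : R, Ideal.Quotient.mk I₁ q = Ideal.Quotient.mk I₁ a ∧
        Ideal.Quotient.mk I₂ q = Ideal.Quotient.mk I₂ b) ↔
      Ideal.Quotient.mk (I₁ ⊔ I₂) a = Ideal.Quotient.mk (I₁ ⊔ I₂) b := by
  constructor
  · rintro ⟨q, h₁, h₂⟩
    rw [Ideal.Quotient.eq] at h₁ h₂ ⊢
    have e : a - b = (q - b) - (q - a) := by ring
    rw [e]
    exact Ideal.sub_mem _ (Ideal.mem_sup_right h₂) (Ideal.mem_sup_left h₁)
  · intro h
    rw [Ideal.Quotient.eq] at h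
    obtain ⟨u₁, hu₁, u₂, hu₂, hab⟩ := Submodule.mem_sup.mp h
    refine ⟨a - u₁, ?_, ?_⟩
    · rw [Ideal.Quotient.eq]
      have e : a - u₁ - a = -u₁ := by ring
      rw [e]
      exact I₁.neg_mem hu₁
    · rw [Ideal.Quotient.eq]
      have e : a - u₁ - b = (a - b) - u₁ := by ring
      rw [e, ← hab, add_sub_cancel_left]
      exact hu₂

end FibreProduct

section Functionals

variable {K : Type u} [Field K] {σ : Type v}

/-- **Lemma 3.5** (Hilbert function of the fibre product) for the Gorenstein quotients of two functionals
`ℓ₁, ℓ₂` concentrated in degree `t`, `I_j = annIdeal ℓ_j`, and `T = S/(I₁ + I₂)`: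
`H(S/(I₁∩I₂))(a) + H(T)(a) = H(S/I₁)(a) + H(S/I₂)(a)` in every degree `a` (the Mayer–Vietoris sequence degree by
degree; the tree's lattice identity `hilbert_inf_add_hilbert_sup` for the homogeneous ideals `annIdeal ℓ_j`).
[cite: IarrobinoMcDanielSeceleanu2022, Lemma 3.5] -/
theorem hilbert_inf_add_hilbert_sup_annIdeal [Finite σ] {t : ℕ} {ℓ₁ ℓ₂ : MvPolynomial σ K →ₗ[K] K}
    (hℓ₁ : ∀ p, ℓ₁ (homogeneousComponent t p) = ℓ₁ p) (hℓ₂ : ∀ p, ℓ₂ (homogeneousComponent t p) = ℓ₂ p)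
    (a : ℕ) :
    (finrank K (homogeneousSubmodule σ K a) - finrank K (idealDegree (annIdeal ℓ₁ ⊓ annIdeal ℓ₂) a)) +
      (finrank K (homogeneousSubmodule σ K a) - finrank K (idealDegree (annIdeal ℓ₁ ⊔ annIdeal ℓ₂) a)) =
      (finrank K (homogeneousSubmodule σ K a) - finrank K (idealDegree (annIdeal ℓ₁) a)) +
        (finrank K (homogeneousSubmodule σ K a) - finrank K (idealDegree (annIdeal ℓ₂) a)) :=
  hilbert_inf_add_hilbert_sup (isHomogeneous_annIdeal hℓ₁) (isHomogeneous_annIdeal hℓ₂) a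

/-! ## §2. Thom classes of `S/annIdeal ℓ → S/annIdeal φ` (Lemma 2.1, Definition 2.2, Lemmas 2.6–2.7, Remark 4.3 (b)) -/

section ThomClass

variable {t k : ℕ} {ℓ φ : MvPolynomial σ K →ₗ[K] K}

/-- **Lemma 2.1 (existence of the Thom class), dual-generator form** (Remark 4.3 (b): "the Thom class … is the
element `τ` of `A_{d−k}` such that `τ∘F = H`"): if `ℓ` is concentrated in degree `t`, `φ` in degree `k ≤ t`, and
`annIdeal ℓ ≤ annIdeal φ` (so that `T = S/annIdeal φ` is a quotient of `A = S/annIdeal ℓ`), then there is a form `τ`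
of degree `t − k` with `ℓ(p τ) = φ(p)` for all `p` — "`∫_A τ·a = ∫_T π(a)`". Printed proof: the pairing of `A` is
non-degenerate, so `a ↦ ∫_A(· a)` is onto `Hom(A, K)`; here: the functionals `ℓ(g ·)`, `g ∈ S_{t−k}`, on `S_k` have
common kernel `(annIdeal ℓ)_k ⊆ ker φ`, so `φ|_{S_k}` is one of them. [cite: IarrobinoMcDanielSeceleanu2022, Lemma 2.1] -/
theorem exists_thomClass [Finite σ] (hℓ : ∀ p, ℓ (homogeneousComponent t p) = ℓ p)
    (hφ : ∀ p, φ (homogeneousComponent k p) = φ p) (hkt : k ≤ t) (hle : annIdeal ℓ ≤ annIdeal φ) :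
    ∃ τ : MvPolynomial σ K, τ.IsHomogeneous (t - k) ∧ ℓ ∘ₗ LinearMap.mulRight K τ = φ := by
  classical
  haveI := finite_homogeneousSubmodule (K := K) (σ := σ) k
  have hab : (t - k) + k = t := Nat.sub_add_cancel hkt
  set Λ := gradedMulForm ℓ (t - k) k with hΛ
  -- the common kernel of the `ℓ(g ·)`, `g ∈ S_{t−k}`, is `(annIdeal ℓ)_k`, on which `φ` vanishes
  have hker : ⨅ g : homogeneousSubmodule σ K (t - k), LinearMap.ker (Λ g) ≤
      LinearMap.ker (φ ∘ₗ (homogeneousSubmodule σ K k).subtype) := by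
    intro w hw
    rw [Submodule.mem_iInf] at hw
    rw [LinearMap.mem_ker, LinearMap.coe_comp, Function.comp_apply, Submodule.subtype_apply]
    have hwI : (w : MvPolynomial σ K) ∈ annIdeal ℓ := by
      refine mem_annIdeal_of_forall_isHomogeneous hℓ w.2 (by omega : k + (t - k) = t) fun g hg => ?_
      have h0 := hw ⟨g, hg⟩
      rw [LinearMap.mem_ker, hΛ, gradedMulForm_apply] at h0
      rw [mul_comm]
      exact h0
    exact apply_eq_zero_of_mem_annIdeal (hle hwI)
  have hspan := FiniteDimensional.mem_span_of_iInf_ker_le_ker hker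
  rw [← LinearMap.coe_range, Submodule.span_eq] at hspan
  obtain ⟨τ, hτ⟩ := LinearMap.mem_range.mp hspan
  refine ⟨τ, τ.2, LinearMap.ext fun p => ?_⟩
  rw [LinearMap.coe_comp, Function.comp_apply, LinearMap.mulRight_apply, mul_comm,
    apply_mul_eq_apply_mul_homogeneousComponent hℓ τ.2 hab p, ← hφ p]
  have h1 := LinearMap.congr_fun hτ ⟨homogeneousComponent k p, homogeneousComponent_mem k p⟩
  rw [hΛ, gradedMulForm_apply] at h1
  simpa using h1

/-- **Lemma 2.1 (uniqueness of the Thom class)**: two elements `τ, τ'` with `ℓ(· τ) = ℓ(· τ') ` differ by an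
element of `annIdeal ℓ`, i.e. define the same class in `A = S/annIdeal ℓ` ("unique … `τ ∈ A_{d−k}`"; Remark 4.3 (b):
"`τ` as an element in `Q_{d−k}`, which is unique up to `Ann(F)`").
[cite: IarrobinoMcDanielSeceleanu2022, Lemma 2.1, Remark 4.3 (b)] -/
theorem thomClass_sub_mem_annIdeal {τ τ' : MvPolynomial σ K}
    (h : ℓ ∘ₗ LinearMap.mulRight K τ = ℓ ∘ₗ LinearMap.mulRight K τ') : τ - τ' ∈ annIdeal ℓ := by
  intro p
  have h1 := LinearMap.congr_fun h p
  simp only [LinearMap.coe_comp, Function.comp_apply, LinearMap.mulRight_apply] at h1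
  rw [sub_mul, map_sub, mul_comm τ, mul_comm τ', h1, sub_self]

/-- **Lemmas 2.6–2.7 (the Gysin map `T(k−d) → A` is multiplication by `τ`, and it is injective)**, dual-generator
form: with `φ = ℓ(· τ)` the induced orientation of `T = S/annIdeal φ` (`annIdeal φ = (annIdeal ℓ : τ)`, tree
`annIdeal_comp_mulRight`), `y τ ∈ annIdeal ℓ ↔ y ∈ annIdeal φ`: multiplication by `τ` is well defined on `T` and
injective `T → A` (printed proof: "`∫_A (τ·t)·a' = ∫_T t·π(a')` … non-degeneracy of the pairing").
[cite: IarrobinoMcDanielSeceleanu2022, Lemma 2.6, Lemma 2.7] -/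
theorem mul_thomClass_mem_annIdeal_iff (τ y : MvPolynomial σ K) :
    y * τ ∈ annIdeal ℓ ↔ y ∈ annIdeal (ℓ ∘ₗ LinearMap.mulRight K τ) :=
  (mem_annIdeal_comp_mulRight_iff ℓ τ y).symm

end ThomClass

/-! ## §3. Theorem 4.6: `A ×_T B = Q/(Ann F ∩ Ann G)` and `A #_T B = Q/Ann(F − G)`; Lemmas 3.7–3.9 -/

section ConnectedSum

variable {t e : ℕ} {ℓ₁ ℓ₂ : MvPolynomial σ K →ₗ[K] K} {τ : MvPolynomial σ K}

/-- The connected-sum functional `ℓ₁ − ℓ₂` (`F − G`) is again concentrated in degree `t`.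
[cite: IarrobinoMcDanielSeceleanu2022, Theorem 4.6] -/
theorem sub_homogeneousComponent (hℓ₁ : ∀ p, ℓ₁ (homogeneousComponent t p) = ℓ₁ p)
    (hℓ₂ : ∀ p, ℓ₂ (homogeneousComponent t p) = ℓ₂ p) (p : MvPolynomial σ K) :
    (ℓ₁ - ℓ₂) (homogeneousComponent t p) = (ℓ₁ - ℓ₂) p := by
  simp [hℓ₁ p, hℓ₂ p]

/-- Condition (b) of Theorem 4.6, the automatic half: `Ann(F) + Ann(G) ⊆ Ann(τ∘F)` as soon as (a)
`τ∘F = τ∘G` (both `annIdeal ℓ_j` lie in `annIdeal ℓ_j(· τ)`); so the printed equality (b) is equivalent to the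
inclusion `annIdeal (ℓ₁(· τ)) ≤ annIdeal ℓ₁ ⊔ annIdeal ℓ₂` assumed below. [cite: IarrobinoMcDanielSeceleanu2022, Theorem 4.6] -/
theorem annIdeal_comp_mulRight_eq_sup
    (hglue : ℓ₁ ∘ₗ LinearMap.mulRight K τ = ℓ₂ ∘ₗ LinearMap.mulRight K τ)
    (hT : annIdeal (ℓ₁ ∘ₗ LinearMap.mulRight K τ) ≤ annIdeal ℓ₁ ⊔ annIdeal ℓ₂) :
    annIdeal (ℓ₁ ∘ₗ LinearMap.mulRight K τ) = annIdeal ℓ₁ ⊔ annIdeal ℓ₂ := by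
  refine le_antisymm hT (sup_le (annIdeal_le_annIdeal_comp_mulRight ℓ₁ τ) ?_)
  rw [hglue]
  exact annIdeal_le_annIdeal_comp_mulRight ℓ₂ τ

/-- **Lemma 3.7, exactness on the left (= Lemmas 2.6/2.7 for the total Thom class)**: under (a) `τ∘F = τ∘G`,
`y τ ∈ Ann(F) ∩ Ann(G) ↔ y ∈ Ann(τ∘F)` — multiplication by the total Thom class `τ + Ann(F,G)` is an INJECTION
`T(k−d) → A ×_T B = Q/Ann(F,G)` (printed: "`(Ann(F,G) : τ) = (Ann F : τ) ∩ (Ann G : τ) = Ann(τ∘F) ∩ Ann(τ∘G)`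
(by condition (a))"). [cite: IarrobinoMcDanielSeceleanu2022, Lemma 3.7, Theorem 4.6 (proof)] -/
theorem mul_mem_inf_annIdeal_iff (hglue : ℓ₁ ∘ₗ LinearMap.mulRight K τ = ℓ₂ ∘ₗ LinearMap.mulRight K τ)
    (y : MvPolynomial σ K) :
    y * τ ∈ annIdeal ℓ₁ ⊓ annIdeal ℓ₂ ↔ y ∈ annIdeal (ℓ₁ ∘ₗ LinearMap.mulRight K τ) := by
  rw [Ideal.mem_inf, mul_thomClass_mem_annIdeal_iff, mul_thomClass_mem_annIdeal_iff, ← hglue, and_self]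

/-- Under (a) alone: **`Ann(F) ∩ Ann(G) + (τ) ⊆ Ann(F − G)`** — the connected-sum quotient `Q/(Ann(F,G) + (τ))`
of Definition 3.6 surjects onto `Q/Ann(F − G)` (`τ` kills `F − G` because `τ∘F = τ∘G`).
[cite: IarrobinoMcDanielSeceleanu2022, Theorem 4.6 (proof)] -/
theorem inf_sup_span_le_annIdeal_sub (hglue : ℓ₁ ∘ₗ LinearMap.mulRight K τ = ℓ₂ ∘ₗ LinearMap.mulRight K τ) :
    (annIdeal ℓ₁ ⊓ annIdeal ℓ₂) ⊔ Ideal.span {τ} ≤ annIdeal (ℓ₁ - ℓ₂) := by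
  refine sup_le (fun g hg h => ?_) ((Ideal.span_singleton_le_iff_mem _).mpr fun h => ?_)
  · rw [LinearMap.sub_apply, hg.1 h, hg.2 h, sub_zero]
  · have h1 := LinearMap.congr_fun hglue h
    simp only [LinearMap.coe_comp, Function.comp_apply, LinearMap.mulRight_apply] at h1
    rw [LinearMap.sub_apply, mul_comm, h1, sub_self]

/-- Bookkeeping for the key step: if `f` kills `ℓ₁ − ℓ₂` then `w ↦ ℓ₁(f w)` vanishes on `Ann(F) + Ann(G)` in every
degree (`ℓ₁(f u₁) = 0` for `u₁ ∈ Ann F`, and `ℓ₁(f u₂) = ℓ₂(f u₂) = 0` for `u₂ ∈ Ann G`).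
[cite: IarrobinoMcDanielSeceleanu2022, Theorem 4.6 (proof)] -/
theorem apply_mul_eq_zero_of_mem_annIdeal_sub {f w : MvPolynomial σ K} (hf : f ∈ annIdeal (ℓ₁ - ℓ₂))
    (hw : w ∈ annIdeal ℓ₁ ⊔ annIdeal ℓ₂) : ℓ₁ (f * w) = 0 := by
  obtain ⟨u₁, hu₁, u₂, hu₂, rfl⟩ := Submodule.mem_sup.mp hw
  have e₁ : ℓ₁ (f * u₁) = 0 := by rw [mul_comm]; exact hu₁ f
  have e₂ : ℓ₂ (f * u₂) = 0 := by rw [mul_comm]; exact hu₂ f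
  have e₃ : ℓ₁ (f * u₂) - ℓ₂ (f * u₂) = 0 := by simpa using hf u₂
  rw [e₂, sub_zero] at e₃
  rw [mul_add, map_add, e₁, e₃, add_zero]

/-- The key step in LOW degree: under (a) and (b), a form `f` of degree `i < e = deg τ` killing `ℓ₁ − ℓ₂` already
lies in `Ann(F) ∩ Ann(G)` (for `i + b = t` every form of degree `b` lies in `(Ann(τ∘F))_b = S_b`, because `b + e > t`,
hence in `(Ann F)_b + (Ann G)_b`, on which `ℓ_j(f ·)` vanish). [cite: IarrobinoMcDanielSeceleanu2022, Theorem 4.6 (proof), Lemma 3.9] -/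
theorem mem_inf_annIdeal_of_mem_annIdeal_sub_of_lt
    (hℓ₁ : ∀ p, ℓ₁ (homogeneousComponent t p) = ℓ₁ p) (hℓ₂ : ∀ p, ℓ₂ (homogeneousComponent t p) = ℓ₂ p)
    (hτ : τ.IsHomogeneous e)
    (hT : annIdeal (ℓ₁ ∘ₗ LinearMap.mulRight K τ) ≤ annIdeal ℓ₁ ⊔ annIdeal ℓ₂)
    {f : MvPolynomial σ K} {i : ℕ} (hfi : f.IsHomogeneous i) (hie : i < e) (hf : f ∈ annIdeal (ℓ₁ - ℓ₂)) :
    f ∈ annIdeal ℓ₁ ⊓ annIdeal ℓ₂ := by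
  rcases lt_or_ge t i with hti | hit
  · exact ⟨mem_annIdeal_of_isHomogeneous_of_lt hℓ₁ hfi hti, mem_annIdeal_of_isHomogeneous_of_lt hℓ₂ hfi hti⟩
  have hib : i + (t - i) = t := by omega
  -- every form `w` of degree `t − i` lies in `Ann(τ∘F) ⊆ Ann F + Ann G`, degreewise
  have hw : ∀ w : MvPolynomial σ K, w.IsHomogeneous (t - i) → w ∈ annIdeal ℓ₁ ⊔ annIdeal ℓ₂ := by
    intro w hw
    refine hT ((mul_thomClass_mem_annIdeal_iff τ w).mp ?_)
    exact mem_annIdeal_of_isHomogeneous_of_lt hℓ₁ (hw.mul hτ) (by omega)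
  have h1 : ∀ w : MvPolynomial σ K, w.IsHomogeneous (t - i) → ℓ₁ (f * w) = 0 := fun w hw' =>
    apply_mul_eq_zero_of_mem_annIdeal_sub hf (hw w hw')
  have h2 : ∀ w : MvPolynomial σ K, w.IsHomogeneous (t - i) → ℓ₂ (f * w) = 0 := by
    intro w hw'
    have e₃ : ℓ₁ (f * w) - ℓ₂ (f * w) = 0 := by simpa using hf w
    rwa [h1 w hw', zero_sub, neg_eq_zero] at e₃
  exact ⟨mem_annIdeal_of_forall_isHomogeneous hℓ₁ hfi hib h1, mem_annIdeal_of_forall_isHomogeneous hℓ₂ hfi hib h2⟩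

/-- The key step in degree `i = a + e`: under (a) and (b), a form `f` of degree `a + e` killing `ℓ₁ − ℓ₂` is
`g τ` modulo `Ann(F) ∩ Ann(G)` for a form `g` of degree `a` — the functional `w ↦ ℓ₁(f w) = ℓ₂(f w)` on `S_{t−i}`
vanishes on `(Ann(τ∘F))_{t−i}`, so by the perfect pairing of `T = Q/Ann(τ∘F)` it is `w ↦ (τ∘F)(g w) = ℓ_j(g τ w)`,
and `f − gτ ⊥ S_{t−i}` for both `ℓ_j`. [cite: IarrobinoMcDanielSeceleanu2022, Theorem 4.6 (proof)] -/
theorem mem_inf_sup_span_of_mem_annIdeal_sub [Finite σ]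
    (hℓ₁ : ∀ p, ℓ₁ (homogeneousComponent t p) = ℓ₁ p) (hℓ₂ : ∀ p, ℓ₂ (homogeneousComponent t p) = ℓ₂ p)
    (hτ : τ.IsHomogeneous e) (hglue : ℓ₁ ∘ₗ LinearMap.mulRight K τ = ℓ₂ ∘ₗ LinearMap.mulRight K τ)
    (hT : annIdeal (ℓ₁ ∘ₗ LinearMap.mulRight K τ) ≤ annIdeal ℓ₁ ⊔ annIdeal ℓ₂)
    {f : MvPolynomial σ K} {i : ℕ} (hfi : f.IsHomogeneous i) (hf : f ∈ annIdeal (ℓ₁ - ℓ₂)) :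
    f ∈ (annIdeal ℓ₁ ⊓ annIdeal ℓ₂) ⊔ Ideal.span {τ} := by
  classical
  rcases lt_or_ge i e with hie | hei
  · exact Ideal.mem_sup_left (mem_inf_annIdeal_of_mem_annIdeal_sub_of_lt hℓ₁ hℓ₂ hτ hT hfi hie hf)
  rcases lt_or_ge t i with hti | hit
  · exact Ideal.mem_sup_left
      ⟨mem_annIdeal_of_isHomogeneous_of_lt hℓ₁ hfi hti, mem_annIdeal_of_isHomogeneous_of_lt hℓ₂ hfi hti⟩
  -- degrees: `i = a + e`, `b = t − i`, `φ = ℓ₁(· τ)` is concentrated in degree `a + b = t − e`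
  obtain ⟨a, rfl⟩ : ∃ a, i = a + e := ⟨i - e, by omega⟩
  set b := t - (a + e) with hb
  have hib : (a + e) + b = t := by omega
  set φ : MvPolynomial σ K →ₗ[K] K := ℓ₁ ∘ₗ LinearMap.mulRight K τ with hφdef
  have hφ : ∀ p, φ (homogeneousComponent (a + b) p) = φ p :=
    comp_mulRight_homogeneousComponent hℓ₁ hτ (by omega)
  haveI := finite_homogeneousSubmodule (K := K) (σ := σ) b
  -- the functionals `φ(g ·)`, `g ∈ S_a`, on `S_b`; their common kernel is `(Ann φ)_b`
  set Λ := gradedMulForm φ a b with hΛ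
  set μ : homogeneousSubmodule σ K b →ₗ[K] K :=
    gradedMulForm ℓ₁ (a + e) b ⟨f, hfi⟩ with hμ
  have hker : ⨅ g : homogeneousSubmodule σ K a, LinearMap.ker (Λ g) ≤ LinearMap.ker μ := by
    intro w hw
    rw [Submodule.mem_iInf] at hw
    have hwφ : (w : MvPolynomial σ K) ∈ annIdeal φ := by
      refine mem_annIdeal_of_forall_isHomogeneous hφ w.2 (by omega : b + a = a + b) fun g hg => ?_
      have h0 := hw ⟨g, hg⟩
      rw [LinearMap.mem_ker, hΛ, gradedMulForm_apply] at h0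
      rw [mul_comm]
      exact h0
    rw [LinearMap.mem_ker, hμ, gradedMulForm_apply]
    exact apply_mul_eq_zero_of_mem_annIdeal_sub hf (hT hwφ)
  have hspan := FiniteDimensional.mem_span_of_iInf_ker_le_ker hker
  rw [← LinearMap.coe_range, Submodule.span_eq] at hspan
  obtain ⟨g, hg⟩ := LinearMap.mem_range.mp hspan
  -- `ℓ_j(f w) = φ(g w) = ℓ_j(g τ w)` for every form `w` of degree `b`
  have hgw : ∀ w : MvPolynomial σ K, w.IsHomogeneous b → ℓ₁ (f * w) = φ ((g : MvPolynomial σ K) * w) := by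
    intro w hw
    have h1 := LinearMap.congr_fun hg ⟨w, hw⟩
    rw [hΛ, hμ, gradedMulForm_apply, gradedMulForm_apply] at h1
    exact h1.symm
  have hdeg : (f - (g : MvPolynomial σ K) * τ).IsHomogeneous (a + e) := hfi.sub (g.2.mul hτ)
  have hd₁ : f - (g : MvPolynomial σ K) * τ ∈ annIdeal ℓ₁ := by
    refine mem_annIdeal_of_forall_isHomogeneous hℓ₁ hdeg hib fun w hw => ?_
    rw [sub_mul, map_sub, hgw w hw, hφdef]
    simp [mul_right_comm]
  have hd₂ : f - (g : MvPolynomial σ K) * τ ∈ annIdeal ℓ₂ := by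
    refine mem_annIdeal_of_forall_isHomogeneous hℓ₂ hdeg hib fun w hw => ?_
    have e₃ : ℓ₁ (f * w) - ℓ₂ (f * w) = 0 := by simpa using hf w
    rw [sub_eq_zero] at e₃
    rw [sub_mul, map_sub, ← e₃, hgw w hw, hglue]
    simp [mul_right_comm]
  have e : f = (f - (g : MvPolynomial σ K) * τ) + (g : MvPolynomial σ K) * τ := by ring
  rw [e]
  exact Ideal.add_mem _ (Ideal.mem_sup_left ⟨hd₁, hd₂⟩)
    (Ideal.mem_sup_right (Ideal.mem_span_singleton'.mpr ⟨g, rfl⟩))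

/-- **Theorem 4.6 (= Theorem 1), the connected sum: `Ann(F − G) = Ann(F) ∩ Ann(G) + (τ)`**, i.e.
`A #_T B = (A ×_T B)/⟨(τ_A, τ_B)⟩ = Q/(Ann(F,G) + (τ)) ≅ Q/Ann(F − G)`, for functionals `ℓ₁, ℓ₂` (`F, G`)
concentrated in degree `t`, a form `τ` of degree `e` with (a) `ℓ₁(· τ) = ℓ₂(· τ)` and (b)
`Ann(ℓ₁(· τ)) ⊆ Ann ℓ₁ + Ann ℓ₂` (hence `=`, `annIdeal_comp_mulRight_eq_sup`). The printed hypotheses "`≠ 0`" in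
(a), `k < d` and the linear independence of `F, G` are not needed for this identity.
[cite: IarrobinoMcDanielSeceleanu2022, Theorem 4.6] -/
theorem annIdeal_sub_eq_inf_sup_span [Finite σ]
    (hℓ₁ : ∀ p, ℓ₁ (homogeneousComponent t p) = ℓ₁ p) (hℓ₂ : ∀ p, ℓ₂ (homogeneousComponent t p) = ℓ₂ p)
    (hτ : τ.IsHomogeneous e) (hglue : ℓ₁ ∘ₗ LinearMap.mulRight K τ = ℓ₂ ∘ₗ LinearMap.mulRight K τ)
    (hT : annIdeal (ℓ₁ ∘ₗ LinearMap.mulRight K τ) ≤ annIdeal ℓ₁ ⊔ annIdeal ℓ₂) :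
    annIdeal (ℓ₁ - ℓ₂) = (annIdeal ℓ₁ ⊓ annIdeal ℓ₂) ⊔ Ideal.span {τ} := by
  classical
  refine le_antisymm (fun f hf => ?_) (inf_sup_span_le_annIdeal_sub hglue)
  rw [← sum_homogeneousComponent f]
  refine Ideal.sum_mem _ fun i _ => ?_
  exact mem_inf_sup_span_of_mem_annIdeal_sub hℓ₁ hℓ₂ hτ hglue hT (homogeneousComponent_isHomogeneous i f)
    (homogeneousComponent_mem_annIdeal (sub_homogeneousComponent hℓ₁ hℓ₂) hf i)

/-- **Lemma 3.8**: the connected sum `Q/Ann(F − G)` is a graded Artinian Gorenstein algebra of socle degree `t`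
(in the tree's predicate `IsArtinianGorenstein`, [cite: DuqueFrancoVillaflor2025Join, Definition 2.1]) as soon as
`F ≠ G` — in the dual-generator model this is Macaulay's theorem for the non-zero functional `ℓ₁ − ℓ₂` (tree
`isArtinianGorenstein_annIdeal`); the printed hypothesis "`F, G` linearly independent" implies `F ≠ G`.
[cite: IarrobinoMcDanielSeceleanu2022, Lemma 3.8] -/
theorem isArtinianGorenstein_annIdeal_sub [Finite σ]
    (hℓ₁ : ∀ p, ℓ₁ (homogeneousComponent t p) = ℓ₁ p) (hℓ₂ : ∀ p, ℓ₂ (homogeneousComponent t p) = ℓ₂ p)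
    (hne : ℓ₁ ≠ ℓ₂) : IsArtinianGorenstein (annIdeal (ℓ₁ - ℓ₂)) t :=
  isArtinianGorenstein_annIdeal (sub_homogeneousComponent hℓ₁ hℓ₂) (sub_ne_zero.mpr hne)

/-- **Lemma 3.7 in dimensions** (the multiplication sequence `0 → Q/(I:τ)(−e) →·τ Q/I → Q/(I+(τ)) → 0` of
Remark 3.10 with `I = Ann(F) ∩ Ann(G)`, `(I : τ) = Ann(τ∘F)`), under (a) alone:
`dim (I + (τ))_{a+e} + dim (Ann(τ∘F))_a = dim I_{a+e} + dim S_a`.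
[cite: IarrobinoMcDanielSeceleanu2022, Lemma 3.7, Remark 3.10] -/
theorem finrank_idealDegree_inf_sup_span_add [Finite σ]
    (hℓ₁ : ∀ p, ℓ₁ (homogeneousComponent t p) = ℓ₁ p) (hℓ₂ : ∀ p, ℓ₂ (homogeneousComponent t p) = ℓ₂ p)
    (hτ : τ.IsHomogeneous e) (hglue : ℓ₁ ∘ₗ LinearMap.mulRight K τ = ℓ₂ ∘ₗ LinearMap.mulRight K τ) (a : ℕ) :
    finrank K (idealDegree ((annIdeal ℓ₁ ⊓ annIdeal ℓ₂) ⊔ Ideal.span {τ}) (a + e)) +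
        finrank K (idealDegree (annIdeal (ℓ₁ ∘ₗ LinearMap.mulRight K τ)) a) =
      finrank K (idealDegree (annIdeal ℓ₁ ⊓ annIdeal ℓ₂) (a + e)) +
        finrank K (homogeneousSubmodule σ K a) := by
  classical
  haveI := finite_homogeneousSubmodule (K := K) (σ := σ) a
  set I : Ideal (MvPolynomial σ K) := annIdeal ℓ₁ ⊓ annIdeal ℓ₂ with hIdef
  have hI : I.IsHomogeneous (homogeneousSubmodule σ K) :=
    (isHomogeneous_annIdeal hℓ₁).inf (isHomogeneous_annIdeal hℓ₂)
  rcases eq_or_ne τ 0 with hτ0 | hτ0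
  · -- `τ = 0`: `(τ) = 0`, `τ∘F = 0`, `Ann(τ∘F) = S`
    have h0 : ℓ₁ ∘ₗ LinearMap.mulRight K τ = 0 := LinearMap.ext fun p => by simp [hτ0]
    have htop : annIdeal (ℓ₁ ∘ₗ LinearMap.mulRight K τ) = ⊤ := annIdeal_eq_top_iff.mpr h0
    rw [htop, idealDegree_top, hτ0, Ideal.span_singleton_zero, sup_bot_eq]
  -- `(I + (τ))_{a+e} = I_{a+e} + τ S_a` and `I_{a+e} ∩ τ S_a = τ (Ann(τ∘F))_a`
  have h1 := Submodule.finrank_sup_add_finrank_inf_eq (idealDegree I (a + e))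
    ((homogeneousSubmodule σ K a).map (LinearMap.mulLeft K τ))
  rw [← idealDegree_sup_span_singleton hI hτ a, finrank_map_mulLeft hτ0] at h1
  have hinf : idealDegree I (a + e) ⊓ (homogeneousSubmodule σ K a).map (LinearMap.mulLeft K τ) =
      (idealDegree (annIdeal (ℓ₁ ∘ₗ LinearMap.mulRight K τ)) a).map (LinearMap.mulLeft K τ) := by
    ext f
    simp only [Submodule.mem_inf, Submodule.mem_map, LinearMap.mulLeft_apply, mem_idealDegree]
    constructor
    · rintro ⟨⟨hfI, -⟩, y, hya, rfl⟩
      refine ⟨y, ⟨(mul_mem_inf_annIdeal_iff hglue y).mp ?_, hya⟩, rfl⟩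
      rwa [mul_comm] at hfI
    · rintro ⟨y, ⟨hyφ, hya⟩, rfl⟩
      refine ⟨⟨?_, ?_⟩, y, hya, rfl⟩
      · rw [mul_comm]; exact (mul_mem_inf_annIdeal_iff hglue y).mpr hyφ
      · simpa [add_comm] using hτ.mul hya
  rw [hinf, finrank_map_mulLeft hτ0] at h1
  omega

/-- **Lemma 3.9, dimension core** (Theorem 4.6 + Lemma 3.7): under (a) and (b),
`dim (Ann(F−G))_{a+e} + dim (Ann(τ∘F))_a = dim (Ann(F) ∩ Ann(G))_{a+e} + dim S_a` for every `a`.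
[cite: IarrobinoMcDanielSeceleanu2022, Lemma 3.9] -/
theorem finrank_idealDegree_annIdeal_sub_add [Finite σ]
    (hℓ₁ : ∀ p, ℓ₁ (homogeneousComponent t p) = ℓ₁ p) (hℓ₂ : ∀ p, ℓ₂ (homogeneousComponent t p) = ℓ₂ p)
    (hτ : τ.IsHomogeneous e) (hglue : ℓ₁ ∘ₗ LinearMap.mulRight K τ = ℓ₂ ∘ₗ LinearMap.mulRight K τ)
    (hT : annIdeal (ℓ₁ ∘ₗ LinearMap.mulRight K τ) ≤ annIdeal ℓ₁ ⊔ annIdeal ℓ₂) (a : ℕ) :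
    finrank K (idealDegree (annIdeal (ℓ₁ - ℓ₂)) (a + e)) +
        finrank K (idealDegree (annIdeal (ℓ₁ ∘ₗ LinearMap.mulRight K τ)) a) =
      finrank K (idealDegree (annIdeal ℓ₁ ⊓ annIdeal ℓ₂) (a + e)) +
        finrank K (homogeneousSubmodule σ K a) := by
  rw [annIdeal_sub_eq_inf_sup_span hℓ₁ hℓ₂ hτ hglue hT]
  exact finrank_idealDegree_inf_sup_span_add hℓ₁ hℓ₂ hτ hglue a

/-- In degrees below `e = deg τ` the connected sum and the fibre product agree: `(Ann(F−G))_a = (Ann(F) ∩ Ann(G))_a`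
for `a < e` (under (a), (b)). [cite: IarrobinoMcDanielSeceleanu2022, Lemma 3.9] -/
theorem idealDegree_annIdeal_sub_eq_of_lt
    (hℓ₁ : ∀ p, ℓ₁ (homogeneousComponent t p) = ℓ₁ p) (hℓ₂ : ∀ p, ℓ₂ (homogeneousComponent t p) = ℓ₂ p)
    (hτ : τ.IsHomogeneous e) (hglue : ℓ₁ ∘ₗ LinearMap.mulRight K τ = ℓ₂ ∘ₗ LinearMap.mulRight K τ)
    (hT : annIdeal (ℓ₁ ∘ₗ LinearMap.mulRight K τ) ≤ annIdeal ℓ₁ ⊔ annIdeal ℓ₂) {a : ℕ} (hae : a < e) :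
    idealDegree (annIdeal (ℓ₁ - ℓ₂)) a = idealDegree (annIdeal ℓ₁ ⊓ annIdeal ℓ₂) a := by
  refine le_antisymm (fun f hf => ?_)
    (idealDegree_mono (le_sup_left.trans (inf_sup_span_le_annIdeal_sub hglue)) a)
  exact ⟨mem_inf_annIdeal_of_mem_annIdeal_sub_of_lt hℓ₁ hℓ₂ hτ hT hf.2 hae hf.1, hf.2⟩

/-- **Lemma 3.9 (Hilbert function of the connected sum), as printed: `H(A #_T B) = H(A) + H(B) − H(T) − H(T)[d−k]`**,
degree by degree in the degrees `a + e` (`e = d − k = deg τ`), written additively: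
`H(A#_TB)(a+e) + H(T)(a+e) + H(T)(a) = H(A)(a+e) + H(B)(a+e)`, where `A = S/annIdeal ℓ₁`, `B = S/annIdeal ℓ₂`,
`T = S/(annIdeal ℓ₁ + annIdeal ℓ₂)` (`= S/Ann(τ∘F)` by (b)), `A #_T B = S/annIdeal (ℓ₁ − ℓ₂)` (Theorem 4.6).
[cite: IarrobinoMcDanielSeceleanu2022, Lemma 3.9] -/
theorem hilbert_connectedSum_add [Finite σ]
    (hℓ₁ : ∀ p, ℓ₁ (homogeneousComponent t p) = ℓ₁ p) (hℓ₂ : ∀ p, ℓ₂ (homogeneousComponent t p) = ℓ₂ p)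
    (hτ : τ.IsHomogeneous e) (hglue : ℓ₁ ∘ₗ LinearMap.mulRight K τ = ℓ₂ ∘ₗ LinearMap.mulRight K τ)
    (hT : annIdeal (ℓ₁ ∘ₗ LinearMap.mulRight K τ) ≤ annIdeal ℓ₁ ⊔ annIdeal ℓ₂) (a : ℕ) :
    (finrank K (homogeneousSubmodule σ K (a + e)) - finrank K (idealDegree (annIdeal (ℓ₁ - ℓ₂)) (a + e))) +
      (finrank K (homogeneousSubmodule σ K (a + e)) -
        finrank K (idealDegree (annIdeal ℓ₁ ⊔ annIdeal ℓ₂) (a + e))) +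
      (finrank K (homogeneousSubmodule σ K a) - finrank K (idealDegree (annIdeal ℓ₁ ⊔ annIdeal ℓ₂) a)) =
      (finrank K (homogeneousSubmodule σ K (a + e)) - finrank K (idealDegree (annIdeal ℓ₁) (a + e))) +
        (finrank K (homogeneousSubmodule σ K (a + e)) - finrank K (idealDegree (annIdeal ℓ₂) (a + e))) := by
  have h1 := finrank_idealDegree_annIdeal_sub_add hℓ₁ hℓ₂ hτ hglue hT a
  rw [annIdeal_comp_mulRight_eq_sup hglue hT] at h1
  have h2 := hilbert_inf_add_hilbert_sup_annIdeal hℓ₁ hℓ₂ (a + e)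
  have h3 := finrank_idealDegree_le (annIdeal (ℓ₁ - ℓ₂)) (a + e)
  have h4 := finrank_idealDegree_le (annIdeal ℓ₁ ⊔ annIdeal ℓ₂) a
  have h5 := finrank_idealDegree_le (annIdeal ℓ₁ ⊓ annIdeal ℓ₂) (a + e)
  have h6 := finrank_idealDegree_le (annIdeal ℓ₁ ⊔ annIdeal ℓ₂) (a + e)
  omega

/-- **Lemma 3.9 in the degrees `a < e = d − k`** (where `H(T)[d−k]` contributes nothing):
`H(A#_TB)(a) + H(T)(a) = H(A)(a) + H(B)(a)`. [cite: IarrobinoMcDanielSeceleanu2022, Lemma 3.9] -/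
theorem hilbert_connectedSum_add_of_lt [Finite σ]
    (hℓ₁ : ∀ p, ℓ₁ (homogeneousComponent t p) = ℓ₁ p) (hℓ₂ : ∀ p, ℓ₂ (homogeneousComponent t p) = ℓ₂ p)
    (hτ : τ.IsHomogeneous e) (hglue : ℓ₁ ∘ₗ LinearMap.mulRight K τ = ℓ₂ ∘ₗ LinearMap.mulRight K τ)
    (hT : annIdeal (ℓ₁ ∘ₗ LinearMap.mulRight K τ) ≤ annIdeal ℓ₁ ⊔ annIdeal ℓ₂) {a : ℕ} (hae : a < e) :
    (finrank K (homogeneousSubmodule σ K a) - finrank K (idealDegree (annIdeal (ℓ₁ - ℓ₂)) a)) +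
      (finrank K (homogeneousSubmodule σ K a) - finrank K (idealDegree (annIdeal ℓ₁ ⊔ annIdeal ℓ₂) a)) =
      (finrank K (homogeneousSubmodule σ K a) - finrank K (idealDegree (annIdeal ℓ₁) a)) +
        (finrank K (homogeneousSubmodule σ K a) - finrank K (idealDegree (annIdeal ℓ₂) a)) := by
  rw [idealDegree_annIdeal_sub_eq_of_lt hℓ₁ hℓ₂ hτ hglue hT hae]
  exact hilbert_inf_add_hilbert_sup_annIdeal hℓ₁ hℓ₂ a

/-- Without condition (b): the connected-sum quotient `Q/(Ann(F,G) + (τ))` SURJECTS onto `Q/Ann(F − G)`, so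
`H(Q/Ann(F−G))(a+e) + H(Q/Ann(τ∘F))(a) ≤ H(Q/Ann(F,G))(a+e)` (Lemma 3.7 gives the dimension of the connected-sum
quotient exactly; only the identification with `Ann(F − G)` needs (b)).
[cite: IarrobinoMcDanielSeceleanu2022, Lemma 3.7, Theorem 4.6 (proof)] -/
theorem hilbert_annIdeal_sub_add_le [Finite σ]
    (hℓ₁ : ∀ p, ℓ₁ (homogeneousComponent t p) = ℓ₁ p) (hℓ₂ : ∀ p, ℓ₂ (homogeneousComponent t p) = ℓ₂ p)
    (hτ : τ.IsHomogeneous e) (hglue : ℓ₁ ∘ₗ LinearMap.mulRight K τ = ℓ₂ ∘ₗ LinearMap.mulRight K τ) (a : ℕ) :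
    (finrank K (homogeneousSubmodule σ K (a + e)) - finrank K (idealDegree (annIdeal (ℓ₁ - ℓ₂)) (a + e))) +
      (finrank K (homogeneousSubmodule σ K a) -
        finrank K (idealDegree (annIdeal (ℓ₁ ∘ₗ LinearMap.mulRight K τ)) a)) ≤
      finrank K (homogeneousSubmodule σ K (a + e)) -
        finrank K (idealDegree (annIdeal ℓ₁ ⊓ annIdeal ℓ₂) (a + e)) := by
  have h1 := finrank_idealDegree_inf_sup_span_add hℓ₁ hℓ₂ hτ hglue a
  have h2 := finrank_idealDegree_mono (inf_sup_span_le_annIdeal_sub (ℓ₁ := ℓ₁) (ℓ₂ := ℓ₂) hglue) (a + e)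
  have h3 := finrank_idealDegree_le (annIdeal (ℓ₁ - ℓ₂)) (a + e)
  have h4 := finrank_idealDegree_le (annIdeal (ℓ₁ ∘ₗ LinearMap.mulRight K τ)) a
  omega

/-- **The rank form** (used for catalecticant / period matrices): for `a + b = t` the rank of the pairing
`S_a × S_b → K`, `(g,h) ↦ (ℓ₁ − ℓ₂)(g h)` — the degree-`(a,b)` catalecticant block of the dual generator `F − G` of the
connected sum — is `H(A #_T B)(a) = dim S_a − dim (Ann(F−G))_a` (tree `finrank_range_gradedMulForm`), hence is given
by Lemma 3.9. [cite: IarrobinoMcDanielSeceleanu2022, Lemma 3.9, Theorem 4.6] -/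
theorem finrank_range_gradedMulForm_sub [Finite σ]
    (hℓ₁ : ∀ p, ℓ₁ (homogeneousComponent t p) = ℓ₁ p) (hℓ₂ : ∀ p, ℓ₂ (homogeneousComponent t p) = ℓ₂ p)
    (hτ : τ.IsHomogeneous e) (hglue : ℓ₁ ∘ₗ LinearMap.mulRight K τ = ℓ₂ ∘ₗ LinearMap.mulRight K τ)
    (hT : annIdeal (ℓ₁ ∘ₗ LinearMap.mulRight K τ) ≤ annIdeal ℓ₁ ⊔ annIdeal ℓ₂) {a b : ℕ}
    (hab : (a + e) + b = t) :
    finrank K (LinearMap.range (gradedMulForm (ℓ₁ - ℓ₂) (a + e) b)) +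
      (finrank K (homogeneousSubmodule σ K (a + e)) -
        finrank K (idealDegree (annIdeal ℓ₁ ⊔ annIdeal ℓ₂) (a + e))) +
      (finrank K (homogeneousSubmodule σ K a) - finrank K (idealDegree (annIdeal ℓ₁ ⊔ annIdeal ℓ₂) a)) =
      (finrank K (homogeneousSubmodule σ K (a + e)) - finrank K (idealDegree (annIdeal ℓ₁) (a + e))) +
        (finrank K (homogeneousSubmodule σ K (a + e)) - finrank K (idealDegree (annIdeal ℓ₂) (a + e))) := by
  rw [finrank_range_gradedMulForm (sub_homogeneousComponent hℓ₁ hℓ₂) hab]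
  exact hilbert_connectedSum_add hℓ₁ hℓ₂ hτ hglue hT a

end ConnectedSum

/-! ## §4. Two Thom lifts `τ₁, τ₂` with `π_A(τ_A) = π_B(τ_B)` (Definition 3.6) glue to one `τ` -/

section Glue

variable {t e : ℕ} {ℓ₁ ℓ₂ : MvPolynomial σ K →ₗ[K] K} {τ₁ τ₂ : MvPolynomial σ K}

/-- Changing a Thom lift by an element of `annIdeal ℓ` does not change `ℓ(· τ)` (the Thom class lives in
`A = S/annIdeal ℓ`). [cite: IarrobinoMcDanielSeceleanu2022, Remark 4.3 (b)] -/
theorem comp_mulRight_eq_of_sub_mem {ℓ : MvPolynomial σ K →ₗ[K] K} {τ τ' : MvPolynomial σ K}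
    (h : τ - τ' ∈ annIdeal ℓ) : ℓ ∘ₗ LinearMap.mulRight K τ = ℓ ∘ₗ LinearMap.mulRight K τ' := by
  refine LinearMap.ext fun p => ?_
  simp only [LinearMap.coe_comp, Function.comp_apply, LinearMap.mulRight_apply]
  rw [← sub_eq_zero, ← map_sub, ← mul_sub, mul_comm]
  exact h p

/-- **The total Thom class.** If `τ₁, τ₂` are forms of degree `e` representing the Thom classes of
`A → T`, `B → T` for the orientations `ℓ₁, ℓ₂` and a common `T`, i.e. `ℓ₁(· τ₁) = ℓ₂(· τ₂)`, and if
`π_A(τ_A) = π_B(τ_B)` in `T = Q/(Ann F + Ann G)`, i.e. `τ₁ − τ₂ ∈ annIdeal ℓ₁ + annIdeal ℓ₂` (the standing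
hypothesis of Definition 3.6), then "there is a `τ ∈ Q_{d−k}` such that `(τ_A, τ_B) = τ + Ann(F,G)`" (proof of
Theorem 4.6): a single form `τ` of degree `e` with `τ − τ₁ ∈ Ann F`, `τ − τ₂ ∈ Ann G`, and consequently
`ℓ₁(· τ) = ℓ₁(· τ₁) = ℓ₂(· τ₂) = ℓ₂(· τ)` (condition (a) for `τ`).
[cite: IarrobinoMcDanielSeceleanu2022, Definition 3.6, Theorem 4.6 (proof)] -/
theorem exists_thomClass_glue
    (hℓ₁ : ∀ p, ℓ₁ (homogeneousComponent t p) = ℓ₁ p) (hℓ₂ : ∀ p, ℓ₂ (homogeneousComponent t p) = ℓ₂ p)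
    (hτ₁ : τ₁.IsHomogeneous e) (hτ₂ : τ₂.IsHomogeneous e)
    (hglue : ℓ₁ ∘ₗ LinearMap.mulRight K τ₁ = ℓ₂ ∘ₗ LinearMap.mulRight K τ₂)
    (hcompat : τ₁ - τ₂ ∈ annIdeal ℓ₁ ⊔ annIdeal ℓ₂) :
    ∃ τ : MvPolynomial σ K, τ.IsHomogeneous e ∧ τ - τ₁ ∈ annIdeal ℓ₁ ∧ τ - τ₂ ∈ annIdeal ℓ₂ ∧
      ℓ₁ ∘ₗ LinearMap.mulRight K τ = ℓ₁ ∘ₗ LinearMap.mulRight K τ₁ ∧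
      ℓ₁ ∘ₗ LinearMap.mulRight K τ = ℓ₂ ∘ₗ LinearMap.mulRight K τ := by
  -- take homogeneous components of a decomposition `τ₁ − τ₂ = u₁ + u₂`
  have hmem : τ₁ - τ₂ ∈ idealDegree (annIdeal ℓ₁ ⊔ annIdeal ℓ₂) e := ⟨hcompat, hτ₁.sub hτ₂⟩
  rw [idealDegree_sup (isHomogeneous_annIdeal hℓ₁) (isHomogeneous_annIdeal hℓ₂)] at hmem
  obtain ⟨u₁, hu₁, u₂, hu₂, hsum⟩ := Submodule.mem_sup.mp hmem
  refine ⟨τ₁ - u₁, hτ₁.sub hu₁.2, ?_, ?_, ?_, ?_⟩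
  · have e₁ : τ₁ - u₁ - τ₁ = -u₁ := by ring
    rw [e₁]
    exact (annIdeal ℓ₁).neg_mem hu₁.1
  · have e₂ : τ₁ - u₁ - τ₂ = (τ₁ - τ₂) - u₁ := by ring
    rw [e₂, ← hsum, add_sub_cancel_left]
    exact hu₂.1
  · refine comp_mulRight_eq_of_sub_mem ?_
    have e₁ : τ₁ - u₁ - τ₁ = -u₁ := by ring
    rw [e₁]
    exact (annIdeal ℓ₁).neg_mem hu₁.1
  · have h1 : ℓ₁ ∘ₗ LinearMap.mulRight K (τ₁ - u₁) = ℓ₁ ∘ₗ LinearMap.mulRight K τ₁ := by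
      refine comp_mulRight_eq_of_sub_mem ?_
      have e₁ : τ₁ - u₁ - τ₁ = -u₁ := by ring
      rw [e₁]
      exact (annIdeal ℓ₁).neg_mem hu₁.1
    have h2 : ℓ₂ ∘ₗ LinearMap.mulRight K (τ₁ - u₁) = ℓ₂ ∘ₗ LinearMap.mulRight K τ₂ := by
      refine comp_mulRight_eq_of_sub_mem ?_
      have e₂ : τ₁ - u₁ - τ₂ = (τ₁ - τ₂) - u₁ := by ring
      rw [e₂, ← hsum, add_sub_cancel_left]
      exact hu₂.1
    rw [h1, h2, hglue]

/-- **Lemma 3.9 for an arbitrary pair of Thom classes with `π_A(τ_A) = π_B(τ_B)`** (the setting of Definition 3.6,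
via the glued total Thom class): `H(A#_TB)(a+e) + H(T)(a+e) + H(T)(a) = H(A)(a+e) + H(B)(a+e)` with
`A #_T B = S/annIdeal(ℓ₁ − ℓ₂)`, `T = S/(annIdeal ℓ₁ + annIdeal ℓ₂)`, for forms `τ₁, τ₂` of degree `e` with
`ℓ₁(· τ₁) = ℓ₂(· τ₂)` (the two Thom classes of a COMMON orientation of `T`), `τ₁ − τ₂ ∈ Ann F + Ann G`, and
(b) `Ann(ℓ₁(· τ₁)) ⊆ Ann F + Ann G`. [cite: IarrobinoMcDanielSeceleanu2022, Lemma 3.9, Definition 3.6] -/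
theorem hilbert_connectedSum_add' [Finite σ]
    (hℓ₁ : ∀ p, ℓ₁ (homogeneousComponent t p) = ℓ₁ p) (hℓ₂ : ∀ p, ℓ₂ (homogeneousComponent t p) = ℓ₂ p)
    (hτ₁ : τ₁.IsHomogeneous e) (hτ₂ : τ₂.IsHomogeneous e)
    (hglue : ℓ₁ ∘ₗ LinearMap.mulRight K τ₁ = ℓ₂ ∘ₗ LinearMap.mulRight K τ₂)
    (hcompat : τ₁ - τ₂ ∈ annIdeal ℓ₁ ⊔ annIdeal ℓ₂)
    (hT : annIdeal (ℓ₁ ∘ₗ LinearMap.mulRight K τ₁) ≤ annIdeal ℓ₁ ⊔ annIdeal ℓ₂) (a : ℕ) :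
    (finrank K (homogeneousSubmodule σ K (a + e)) - finrank K (idealDegree (annIdeal (ℓ₁ - ℓ₂)) (a + e))) +
      (finrank K (homogeneousSubmodule σ K (a + e)) -
        finrank K (idealDegree (annIdeal ℓ₁ ⊔ annIdeal ℓ₂) (a + e))) +
      (finrank K (homogeneousSubmodule σ K a) - finrank K (idealDegree (annIdeal ℓ₁ ⊔ annIdeal ℓ₂) a)) =
      (finrank K (homogeneousSubmodule σ K (a + e)) - finrank K (idealDegree (annIdeal ℓ₁) (a + e))) +
        (finrank K (homogeneousSubmodule σ K (a + e)) - finrank K (idealDegree (annIdeal ℓ₂) (a + e))) := by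
  obtain ⟨τ, hτ, -, -, h₁, hglue'⟩ := exists_thomClass_glue hℓ₁ hℓ₂ hτ₁ hτ₂ hglue hcompat
  exact hilbert_connectedSum_add hℓ₁ hℓ₂ hτ hglue' (h₁ ▸ hT) a

/-- … and in the degrees `a < e`: `H(A#_TB)(a) + H(T)(a) = H(A)(a) + H(B)(a)`.
[cite: IarrobinoMcDanielSeceleanu2022, Lemma 3.9, Definition 3.6] -/
theorem hilbert_connectedSum_add_of_lt' [Finite σ]
    (hℓ₁ : ∀ p, ℓ₁ (homogeneousComponent t p) = ℓ₁ p) (hℓ₂ : ∀ p, ℓ₂ (homogeneousComponent t p) = ℓ₂ p)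
    (hτ₁ : τ₁.IsHomogeneous e) (hτ₂ : τ₂.IsHomogeneous e)
    (hglue : ℓ₁ ∘ₗ LinearMap.mulRight K τ₁ = ℓ₂ ∘ₗ LinearMap.mulRight K τ₂)
    (hcompat : τ₁ - τ₂ ∈ annIdeal ℓ₁ ⊔ annIdeal ℓ₂)
    (hT : annIdeal (ℓ₁ ∘ₗ LinearMap.mulRight K τ₁) ≤ annIdeal ℓ₁ ⊔ annIdeal ℓ₂) {a : ℕ} (hae : a < e) :
    (finrank K (homogeneousSubmodule σ K a) - finrank K (idealDegree (annIdeal (ℓ₁ - ℓ₂)) a)) +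
      (finrank K (homogeneousSubmodule σ K a) - finrank K (idealDegree (annIdeal ℓ₁ ⊔ annIdeal ℓ₂) a)) =
      (finrank K (homogeneousSubmodule σ K a) - finrank K (idealDegree (annIdeal ℓ₁) a)) +
        (finrank K (homogeneousSubmodule σ K a) - finrank K (idealDegree (annIdeal ℓ₂) a)) := by
  obtain ⟨τ, hτ, -, -, h₁, hglue'⟩ := exists_thomClass_glue hℓ₁ hℓ₂ hτ₁ hτ₂ hglue hcompat
  exact hilbert_connectedSum_add_of_lt hℓ₁ hℓ₂ hτ hglue' (h₁ ▸ hT) hae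

/-- **The rank form for two Thom lifts**: for `(a + e) + b = t` the rank of the catalecticant block
`S_{a+e} × S_b → K` of `ℓ₁ − ℓ₂` satisfies `rank + H(T)(a+e) + H(T)(a) = H(A)(a+e) + H(B)(a+e)`,
`T = S/(annIdeal ℓ₁ + annIdeal ℓ₂)`. [cite: IarrobinoMcDanielSeceleanu2022, Lemma 3.9, Theorem 4.6] -/
theorem finrank_range_gradedMulForm_sub' [Finite σ]
    (hℓ₁ : ∀ p, ℓ₁ (homogeneousComponent t p) = ℓ₁ p) (hℓ₂ : ∀ p, ℓ₂ (homogeneousComponent t p) = ℓ₂ p)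
    (hτ₁ : τ₁.IsHomogeneous e) (hτ₂ : τ₂.IsHomogeneous e)
    (hglue : ℓ₁ ∘ₗ LinearMap.mulRight K τ₁ = ℓ₂ ∘ₗ LinearMap.mulRight K τ₂)
    (hcompat : τ₁ - τ₂ ∈ annIdeal ℓ₁ ⊔ annIdeal ℓ₂)
    (hT : annIdeal (ℓ₁ ∘ₗ LinearMap.mulRight K τ₁) ≤ annIdeal ℓ₁ ⊔ annIdeal ℓ₂) {a b : ℕ}
    (hab : (a + e) + b = t) :
    finrank K (LinearMap.range (gradedMulForm (ℓ₁ - ℓ₂) (a + e) b)) +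
      (finrank K (homogeneousSubmodule σ K (a + e)) -
        finrank K (idealDegree (annIdeal ℓ₁ ⊔ annIdeal ℓ₂) (a + e))) +
      (finrank K (homogeneousSubmodule σ K a) - finrank K (idealDegree (annIdeal ℓ₁ ⊔ annIdeal ℓ₂) a)) =
      (finrank K (homogeneousSubmodule σ K (a + e)) - finrank K (idealDegree (annIdeal ℓ₁) (a + e))) +
        (finrank K (homogeneousSubmodule σ K (a + e)) - finrank K (idealDegree (annIdeal ℓ₂) (a + e))) := by
  rw [finrank_range_gradedMulForm (sub_homogeneousComponent hℓ₁ hℓ₂) hab]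
  exact hilbert_connectedSum_add' hℓ₁ hℓ₂ hτ₁ hτ₂ hglue hcompat hT a

end Glue

end Functionals

end Literature.RingTheory.GradedAlgebra

end
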